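import Summits.QuantumFields.YangMills.Theorems.BalabanUVNodesN18CombStepC1Sum
import Summits.QuantumFields.YangMills.Theorems.BalabanUVNodesN18AvgRemainderUnitsPrelim
import HarnessLib

/-!
# BalabanUVNodes ∕ node N18 = NE5 — closure-ledger item (iii), comb step M4c, file (6c-β):
# PRELIMINARIES FOR THE TRANSPORTED LINEARISATION REMAINDER (file (6c-β)): `Q₁` CONJUGATION, `scale e_ν = L·e_ν`, THE `e_ν`-SWEEP OF `Ad(v)A′`,
# AND THE BASE CHANGE `Ad(v′·axialT U (emb(y+e_ν))) ≈ Ad(v)` INSIDE `Q₁`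

(Track A, DAG node N18 = `T4OutputRate.NE5`; cluster K4 «SpineRates», key item K3⁸ `SpineGivenEndpointR13SepCoPHV` (stmt-QuantumFields-27366);
seat pub-ymgap-dag-n18-w3 g5, INTENT-6 = design step M4c of `COMB-STEP-DESIGN.md` ∕ `COMB-CHAIN-INDEX.md`.)

HONEST FRAMING.  Count-neutral kernel bookkeeping (`--supports stmt-QuantumFields-27366 --as helper`): four letters split off the raw-letter
transport bound (6c-β) `norm_transport_potRem_sub_potRem_le` for the 400-line rule — `linAvg_units_conj` (conjugation by a fixed unit passes
through `Q₁`), `scale_zero_shift`, ★ `norm_adJ_axialT_translate_sub_le` (the pointwise `e_ν`-sweep of (4b): on a two-block bond `b` of `⟨y, μ⟩`,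
`‖(Ad(v)A′)(b + Le_ν) − (Ad(v)A′)(b)‖ ≤ L(ηa₁ + 2ta)` for the pair-box axial gauge `v = axialT U (emb y)`), ★ `norm_conj_linAvg_adJ_shift_sub_le`
(the base change `v′·Ad(axialT U (emb(y+e_ν)))·v′⁻¹ = Ad(H·v)`, `‖H − 1‖ ≤ (ℓ∕2)t` on the two blocks of `c′` — (4d)'s `H` — costs `3ℓ·ℓta` inside `Q₁`).
Nothing of Bałaban's analysis is asserted beyond the cited tree theorems; NE5 NOT printed ∕ NOT proved; N18 NOT discharged; finite tori — nothing
about the continuum ∕ OS ∕ mass gap; YM mass gap (Clay) NOT proved — R4 closes the conditional finite-𝕋⁴ rung `BalabanLadder.UV` only.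

0 `def`, 0 `sorry`.  References: T. Bałaban, CMP **98** (1985) 17–51 [Balaban1985Averaging] (Prop. 3 (122)–(126) p.36, (62)–(63) p.28, (11), (21)–(23) pp.19–21);
CMP **109** (1987) 249–301 [Balaban1987RG1] ((0.4) p.253, (1.10)–(1.13) p.262, (2.17) p.269); Propagators I [Balaban1984PropagatorsI] ((1.11) p.19);
C. King, CMP **102** (1986) 649–677 [King1986] ((3.43)–(3.47) p.661).
-/

noncomputable section

open scoped BigOperators Matrix.Norms.L2Operator
open NormedSpace

namespace YMDAG.N18.TransportOfRecord

open Complex (I)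
open Literature.MathematicalPhysics.QuantumFieldTheory.Balaban1983to89
open Literature.MathematicalPhysics.QuantumFieldTheory.Balaban1983to89.T4Continuum
open Literature.MathematicalPhysics.QuantumFieldTheory.Balaban1983to89.BlockAveraging
open Literature.MathematicalPhysics.QuantumFieldTheory.Balaban1983to89.BlockAveragingEMLLinearised (linAvg combMean linAvg_eq_bondAvg_sub_grad_combMean)
open Literature.MathematicalPhysics.QuantumFieldTheory.Balaban1983to89.LatticeFieldCalculus (bondAvg)
open Literature.MathematicalPhysics.QuantumFieldTheory.Balaban1983to89.B12RegularSpaces111 (expI gaugeU adJ plaq plaq_eq nabla)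
open Literature.MathematicalPhysics.QuantumFieldTheory.Balaban1983to89.B12RegularSpaces111Mono (expI_zero)
open Literature.MathematicalPhysics.QuantumFieldTheory.Balaban1983to89.MatrixLog (mlog)
open Literature.MathematicalPhysics.QuantumFieldTheory.Balaban1983to89.B7Prop1Explicit (l1 U1 mem_U1 treeWord mlog_units_conj)
open Literature.MathematicalPhysics.QuantumFieldTheory.Balaban1983to89.B10Eq27TorusAxialLog (holT rel axialT axialT_self)
open Literature.MathematicalPhysics.QuantumFieldTheory.Balaban1983to89.T4TermwiseBCH (norm_units_conj_le)
open Literature.MathematicalPhysics.QuantumFieldTheory.Balaban1983to89.Node00.W1 (avgUnits)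
open Summit.QuantumFields.YangMills.Theorems.Prop8Chart (emlAvgU_congr₂ norm_emlAvgU_sub_one_sub_linAvg_le)
open Summit.QuantumFields.YangMills.Theorems.Prop7AvgLinearisation (linAvg_sub norm_linAvg_le)
open YMDAG.N18.AvgRemainderUnits (linAvg_congr₂)
open YMDAG.N18.BoxStokes (two_mul_l1_le_of_inBox)

variable {P : Params} {j : ℕ} {n : Type*} [Fintype n] [DecidableEq n] [Nonempty n]

omit [Nonempty n] in
/-- Conjugation by a fixed unit passes through the linearised average `Q₁` (`Q₁Y = L·QY − (λ̄₊ − λ̄₋)`, `bondAvg_units_conj`, `combMean_units_conj`).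
[cite: Balaban1985Averaging, (124)-(125) p.36 (linearity)] -/
theorem linAvg_units_conj (g : (Matrix n n ℂ)ˣ) (Y : PBond P j → Matrix n n ℂ) (c : PBond P (j + 1)) :
    linAvg (fun b => (g : Matrix n n ℂ) * Y b * ((g⁻¹ : (Matrix n n ℂ)ˣ) : Matrix n n ℂ)) c =
      (g : Matrix n n ℂ) * linAvg Y c * ((g⁻¹ : (Matrix n n ℂ)ˣ) : Matrix n n ℂ) := by
  rw [linAvg_eq_bondAvg_sub_grad_combMean, linAvg_eq_bondAvg_sub_grad_combMean, bondAvg_units_conj, combMean_units_conj, combMean_units_conj]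
  simp only [mul_sub, sub_mul, mul_smul_comm, smul_mul_assoc]

/-- `scale e_ν = L • e_ν` one level down (public twin of the private letters of `…AvgPotentialLogChartExp` ∕ `…CombGaugeLetters`). [folklore] -/
theorem scale_zero_shift (ν : Fin P.d) : Site.scale ((0 : Site P (j + 1)).shift ν) = P.L • (0 : Site P j).shift ν := by
  funext κ
  show Site.scaleCoord P j (((0 : Site P (j + 1)).shift ν) κ) = P.L • (((0 : Site P j).shift ν) κ)
  by_cases h : κ = ν
  · have h1 : ((0 : Site P (j + 1)).shift ν) κ = 1 := by rw [Site.shift_apply, if_pos h, Site.zero_apply, zero_add]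
    have h2 : ((0 : Site P j).shift ν) κ = 1 := by rw [Site.shift_apply, if_pos h, Site.zero_apply, zero_add]
    rw [h1, h2, Site.scaleCoord_one, nsmul_eq_mul, mul_one]
  · have h1 : ((0 : Site P (j + 1)).shift ν) κ = 0 := by rw [Site.shift_apply, if_neg h, Site.zero_apply]
    have h2 : ((0 : Site P j).shift ν) κ = 0 := by rw [Site.shift_apply, if_neg h, Site.zero_apply]
    rw [h1, h2, map_zero, smul_zero]

/-- ★ **THE `e_ν`-SWEEP OF `Ad(v)A′`, POINTWISE** ((4b)'s sweep): for the pair-box axial gauge `v = axialT U (emb y)` and a two-block bond `b` of `c = ⟨y, μ⟩`,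
`‖(Ad(v)A′)(b + L·e_ν) − (Ad(v)A′)(b)‖ ≤ L·(η·a₁ + 2t·a)` — `L` unit steps, each `η‖∇^η_{U,ν}A′‖ + 2‖U^v − 1‖·‖A′‖` (`norm_sub_shift_le`), the swept bonds
staying in the pair blocks (`blockOf_add_nsmul_shift_mem_pairBlocks`). [cite: Balaban1987RG1, (1.10)-(1.13) p.262; Balaban1985Averaging, Prop. 3 p.36] -/
theorem norm_adJ_axialT_translate_sub_le (hj : j + 1 ≤ P.m + P.K) (hj2 : j + 2 ≤ P.m + P.K) (y : Site P (j + 1)) (μ ν : Fin P.d)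
    {U : GaugeField P j (Matrix n n ℂ)ˣ} {A : PBond P j → Matrix n n ℂ} {η a a₁ α t : ℝ} (hη : 0 < η) (hα : 0 ≤ α)
    (hU1 : ∀ b : PBond P j, (blockOf b.src = y ∨ blockOf b.src = y.shift μ ∨ blockOf b.src = y.shift ν ∨ blockOf b.src = (y.shift μ).shift ν) →
      (blockOf b.tgt = y ∨ blockOf b.tgt = y.shift μ ∨ blockOf b.tgt = y.shift ν ∨ blockOf b.tgt = (y.shift μ).shift ν) → U b ∈ U1 (Matrix n n ℂ))
    (hplaq : ∀ p : Plaq P j, (blockOf p.src = y ∨ blockOf p.src = y.shift μ ∨ blockOf p.src = y.shift ν ∨ blockOf p.src = (y.shift μ).shift ν) →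
      (blockOf (p.src.shift p.μ) = y ∨ blockOf (p.src.shift p.μ) = y.shift μ ∨ blockOf (p.src.shift p.μ) = y.shift ν ∨
        blockOf (p.src.shift p.μ) = (y.shift μ).shift ν) →
      (blockOf (p.src.shift p.ν) = y ∨ blockOf (p.src.shift p.ν) = y.shift μ ∨ blockOf (p.src.shift p.ν) = y.shift ν ∨
        blockOf (p.src.shift p.ν) = (y.shift μ).shift ν) →
      (blockOf ((p.src.shift p.μ).shift p.ν) = y ∨ blockOf ((p.src.shift p.μ).shift p.ν) = y.shift μ ∨
        blockOf ((p.src.shift p.μ).shift p.ν) = y.shift ν ∨ blockOf ((p.src.shift p.μ).shift p.ν) = (y.shift μ).shift ν) →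
      ‖((plaq U p : (Matrix n n ℂ)ˣ) : Matrix n n ℂ) - 1‖ ≤ α)
    (hA : ∀ b : PBond P j, (blockOf b.src = y ∨ blockOf b.src = y.shift μ ∨ blockOf b.src = y.shift ν ∨ blockOf b.src = (y.shift μ).shift ν) →
      (blockOf b.tgt = y ∨ blockOf b.tgt = y.shift μ ∨ blockOf b.tgt = y.shift ν ∨ blockOf b.tgt = (y.shift μ).shift ν) → ‖A b‖ ≤ a)
    (hA1 : ∀ (z : Site P j) (κ : Fin P.d),
      (blockOf z = y ∨ blockOf z = y.shift μ ∨ blockOf z = y.shift ν ∨ blockOf z = (y.shift μ).shift ν) →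
      (blockOf (z.shift ν) = y ∨ blockOf (z.shift ν) = y.shift μ ∨ blockOf (z.shift ν) = y.shift ν ∨ blockOf (z.shift ν) = (y.shift μ).shift ν) →
      (blockOf (z.shift κ) = y ∨ blockOf (z.shift κ) = y.shift μ ∨ blockOf (z.shift κ) = y.shift ν ∨ blockOf (z.shift κ) = (y.shift μ).shift ν) →
      (blockOf ((z.shift ν).shift κ) = y ∨ blockOf ((z.shift ν).shift κ) = y.shift μ ∨ blockOf ((z.shift ν).shift κ) = y.shift ν ∨ blockOf ((z.shift ν).shift κ) = (y.shift μ).shift ν) →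
      ‖nabla η U ν (fun w => A ⟨w, κ⟩) z‖ ≤ a₁)
    (hRt : ((((P.d + 4) * P.L : ℕ) : ℝ) / 2) * α ≤ t) (b : PBond P j) (h1 : blockOf b.src = y ∨ blockOf b.src = y.shift μ)
    (h2 : blockOf b.tgt = y ∨ blockOf b.tgt = y.shift μ) :
    ‖adJ (axialT U (emb y)) A (b.translate (P.L • (0 : Site P j).shift ν)) - adJ (axialT U (emb y)) A b‖ ≤ (P.L : ℝ) * (η * a₁ + 2 * t * a) := by
  classical
  have ht0 : 0 ≤ t := le_trans (by positivity) hRt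
  -- the pair-box cut-off, its axial gauge (= `axialT U (emb y)` on the pair blocks), `U^v` within `t` there ((4b)/(4d) verbatim)
  let χ : PBond P j → Prop := fun b =>
    (blockOf b.src = y ∨ blockOf b.src = y.shift μ ∨ blockOf b.src = y.shift ν ∨ blockOf b.src = (y.shift μ).shift ν) ∧
    (blockOf b.tgt = y ∨ blockOf b.tgt = y.shift μ ∨ blockOf b.tgt = y.shift ν ∨ blockOf b.tgt = (y.shift μ).shift ν)
  let U' : GaugeField P j (Matrix n n ℂ)ˣ := fun b => if χ b then U b else 1
  have hU'U : ∀ b : PBond P j, (blockOf b.src = y ∨ blockOf b.src = y.shift μ ∨ blockOf b.src = y.shift ν ∨ blockOf b.src = (y.shift μ).shift ν) →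
      (blockOf b.tgt = y ∨ blockOf b.tgt = y.shift μ ∨ blockOf b.tgt = y.shift ν ∨ blockOf b.tgt = (y.shift μ).shift ν) → U' b = U b :=
    fun b h1 h2 => by simp only [U', χ, if_pos (And.intro h1 h2)]
  have hU'1 : ∀ b, U' b ∈ U1 (Matrix n n ℂ) := fun b => by
    by_cases hb : χ b
    · simp only [U', if_pos hb]; exact hU1 b hb.1 hb.2
    · simp only [U', if_neg hb]; exact (U1 _).one_mem
  have hplaq' : ∀ p : Plaq P j, (blockOf p.src = y ∨ blockOf p.src = y.shift μ ∨ blockOf p.src = y.shift ν ∨ blockOf p.src = (y.shift μ).shift ν) →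
      (blockOf (p.src.shift p.μ) = y ∨ blockOf (p.src.shift p.μ) = y.shift μ ∨ blockOf (p.src.shift p.μ) = y.shift ν ∨
        blockOf (p.src.shift p.μ) = (y.shift μ).shift ν) →
      (blockOf (p.src.shift p.ν) = y ∨ blockOf (p.src.shift p.ν) = y.shift μ ∨ blockOf (p.src.shift p.ν) = y.shift ν ∨
        blockOf (p.src.shift p.ν) = (y.shift μ).shift ν) →
      (blockOf ((p.src.shift p.μ).shift p.ν) = y ∨ blockOf ((p.src.shift p.μ).shift p.ν) = y.shift μ ∨
        blockOf ((p.src.shift p.μ).shift p.ν) = y.shift ν ∨ blockOf ((p.src.shift p.μ).shift p.ν) = (y.shift μ).shift ν) →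
      ‖((plaq U' p : (Matrix n n ℂ)ˣ) : Matrix n n ℂ) - 1‖ ≤ α := fun p c1 c2 c3 c4 => by
    have hpe : plaq U' p = plaq U p := by
      rw [plaq_eq, plaq_eq, hU'U ⟨p.src, p.μ⟩ c1 c2, hU'U ⟨p.src.shift p.μ, p.ν⟩ c2 c4, hU'U ⟨p.src, p.ν⟩ c1 c3,
        hU'U ⟨p.src.shift p.ν, p.μ⟩ c3 (by rw [PBond.tgt, Site.shift_comm]; exact c4)]
    rw [hpe]; exact hplaq p c1 c2 c3 c4
  have hvv' : ∀ x : Site P j, (blockOf x = y ∨ blockOf x = y.shift μ ∨ blockOf x = y.shift ν ∨ blockOf x = (y.shift μ).shift ν) →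
      axialT U (emb y) x = axialT U' (emb y) x := fun x hx => (axialT_congr_of_pairBlocks hj hj2 y μ ν hU'U hx).symm
  have hvx1 : ∀ x : Site P j, (blockOf x = y ∨ blockOf x = y.shift μ ∨ blockOf x = y.shift ν ∨ blockOf x = (y.shift μ).shift ν) →
      axialT U (emb y) x ∈ U1 (Matrix n n ℂ) := fun x hx => by rw [hvv' x hx]; exact axialT_mem_U1 hU'1 _ x
  have hV₀ : ∀ b : PBond P j, (blockOf b.src = y ∨ blockOf b.src = y.shift μ ∨ blockOf b.src = y.shift ν ∨ blockOf b.src = (y.shift μ).shift ν) →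
      (blockOf b.tgt = y ∨ blockOf b.tgt = y.shift μ ∨ blockOf b.tgt = y.shift ν ∨ blockOf b.tgt = (y.shift μ).shift ν) →
      gaugeU (axialT U (emb y)) U b ∈ U1 (Matrix n n ℂ) ∧ ‖((gaugeU (axialT U (emb y)) U b : (Matrix n n ℂ)ˣ) : Matrix n n ℂ) - 1‖ ≤ t := fun b h1 h2 => by
    have heq : gaugeU (axialT U (emb y)) U b = gaugeU (axialT U' (emb y)) U' b := by
      simp only [gaugeU, hvv' b.src h1, hvv' b.tgt h2, hU'U b h1 h2]
    rw [heq]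
    refine ⟨(U1 _).mul_mem ((U1 _).mul_mem (axialT_mem_U1 hU'1 _ _) (hU'1 b)) ((U1 _).inv_mem (axialT_mem_U1 hU'1 _ _)), ?_⟩
    exact (norm_gaugeU_axialT_sub_one_le_of_pairBlocks hj hj2 hU'1 y μ ν hα hplaq' b h1 h2).trans hRt
  refine norm_sub_translate_nsmul_le (adJ (axialT U (emb y)) A) _ b P.L fun i hi => ?_
  -- the swept bond `bᵢ = b + i e_ν` ((4b)'s sweep, verbatim)
  set z : Site P j := b.src + i • (0 : Site P j).shift ν with hz
  have hbi : b.translate (i • (0 : Site P j).shift ν) = ⟨z, b.dir⟩ := rfl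
  have hbi' : (b.translate (i • (0 : Site P j).shift ν)).translate ((0 : Site P j).shift ν) = ⟨z.shift ν, b.dir⟩ := by
    rw [PBond.translate_translate]; show (⟨b.src + (i • (0 : Site P j).shift ν + (0 : Site P j).shift ν), b.dir⟩ : PBond P j) = _
    rw [← add_assoc, ← hz, Site.add_zero_shift]
  rw [hbi', hbi]
  have hzmem := blockOf_add_nsmul_shift_mem_pairBlocks hj hj2 y μ ν h1 hi.le
  have hzν : blockOf (z.shift ν) = y ∨ blockOf (z.shift ν) = y.shift μ ∨ blockOf (z.shift ν) = y.shift ν ∨ blockOf (z.shift ν) = (y.shift μ).shift ν := by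
    have h := blockOf_add_nsmul_shift_mem_pairBlocks hj hj2 y μ ν h1 (Nat.succ_le_of_lt hi)
    rwa [succ_nsmul, ← add_assoc, ← hz, Site.add_zero_shift] at h
  have hzκ : blockOf (z.shift b.dir) = y ∨ blockOf (z.shift b.dir) = y.shift μ ∨ blockOf (z.shift b.dir) = y.shift ν ∨
      blockOf (z.shift b.dir) = (y.shift μ).shift ν := by
    have h := blockOf_add_nsmul_shift_mem_pairBlocks hj hj2 y μ ν (x := b.tgt) h2 hi.le
    have heq : b.tgt + i • (0 : Site P j).shift ν = z.shift b.dir := by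
      rw [hz, PBond.tgt, ← Site.add_zero_shift b.src b.dir, ← Site.add_zero_shift (b.src + i • (0 : Site P j).shift ν) b.dir]
      abel
    rwa [heq] at h
  have hzνκ : blockOf ((z.shift ν).shift b.dir) = y ∨ blockOf ((z.shift ν).shift b.dir) = y.shift μ ∨ blockOf ((z.shift ν).shift b.dir) = y.shift ν ∨
      blockOf ((z.shift ν).shift b.dir) = (y.shift μ).shift ν := by
    have h := blockOf_add_nsmul_shift_mem_pairBlocks hj hj2 y μ ν (x := b.tgt) h2 (Nat.succ_le_of_lt hi)
    have heq : b.tgt + (i + 1) • (0 : Site P j).shift ν = (z.shift ν).shift b.dir := by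
      rw [succ_nsmul, hz, PBond.tgt, ← Site.add_zero_shift b.src b.dir,
        ← Site.add_zero_shift ((b.src + i • (0 : Site P j).shift ν).shift ν) b.dir, ← Site.add_zero_shift (b.src + i • (0 : Site P j).shift ν) ν]
      abel
    rwa [heq] at h
  obtain ⟨hVU1, hVt⟩ := hV₀ ⟨z, ν⟩ hzmem hzν
  have hstep := norm_sub_shift_le hη (axialT U (emb y)) U A z ν b.dir (hvx1 z hzmem) (hvx1 _ hzν) hVU1
  refine hstep.trans ?_
  have h1' := hA1 z b.dir hzmem hzν hzκ hzνκ
  have h2' := hA ⟨z.shift ν, b.dir⟩ hzν hzνκ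
  have : 0 ≤ ‖((gaugeU (axialT U (emb y)) U ⟨z, ν⟩ : (Matrix n n ℂ)ˣ) : Matrix n n ℂ) - 1‖ := norm_nonneg _
  nlinarith [mul_le_mul hVt h2' (norm_nonneg _) ht0, norm_nonneg (nabla η U ν (fun w => A ⟨w, b.dir⟩) z)]

/-- ★ **THE BASE CHANGE INSIDE `Q₁` AT `c′ = ⟨y + e_ν, μ⟩`**: with `v = axialT U (emb y)` (pair-box axial gauge), `v′ = v(emb(y + e_ν))` and the axial gauge
`axialT U (emb(y+e_ν))` of the next block, `H_x = v′·axialT U (emb(y+e_ν)) x·v(x)⁻¹` is within `(ℓ∕2)t` of `1` on the two blocks of `c′` ((4d)), hence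
`‖v′·Q₁(Ad(axialT U (emb(y+e_ν)))A′)(c′)·v′⁻¹ − Q₁(Ad(v)A′)(c′)‖ ≤ 3ℓ·(ℓ·t·a)`.
[cite: Balaban1985Averaging, Prop. 3 (124)-(125) p.36, pp.24-25; Balaban1987RG1, (0.4) p.253, (1.12) p.262] -/
theorem norm_conj_linAvg_adJ_shift_sub_le (hj : j + 1 ≤ P.m + P.K) (hj2 : j + 2 ≤ P.m + P.K) (y : Site P (j + 1)) (μ ν : Fin P.d)
    {U : GaugeField P j (Matrix n n ℂ)ˣ} {A : PBond P j → Matrix n n ℂ} {a α t : ℝ} (ha0 : 0 ≤ a) (hα : 0 ≤ α)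
    (hU1 : ∀ b : PBond P j, (blockOf b.src = y ∨ blockOf b.src = y.shift μ ∨ blockOf b.src = y.shift ν ∨ blockOf b.src = (y.shift μ).shift ν) →
      (blockOf b.tgt = y ∨ blockOf b.tgt = y.shift μ ∨ blockOf b.tgt = y.shift ν ∨ blockOf b.tgt = (y.shift μ).shift ν) → U b ∈ U1 (Matrix n n ℂ))
    (hplaq : ∀ p : Plaq P j, (blockOf p.src = y ∨ blockOf p.src = y.shift μ ∨ blockOf p.src = y.shift ν ∨ blockOf p.src = (y.shift μ).shift ν) →
      (blockOf (p.src.shift p.μ) = y ∨ blockOf (p.src.shift p.μ) = y.shift μ ∨ blockOf (p.src.shift p.μ) = y.shift ν ∨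
        blockOf (p.src.shift p.μ) = (y.shift μ).shift ν) →
      (blockOf (p.src.shift p.ν) = y ∨ blockOf (p.src.shift p.ν) = y.shift μ ∨ blockOf (p.src.shift p.ν) = y.shift ν ∨
        blockOf (p.src.shift p.ν) = (y.shift μ).shift ν) →
      (blockOf ((p.src.shift p.μ).shift p.ν) = y ∨ blockOf ((p.src.shift p.μ).shift p.ν) = y.shift μ ∨
        blockOf ((p.src.shift p.μ).shift p.ν) = y.shift ν ∨ blockOf ((p.src.shift p.μ).shift p.ν) = (y.shift μ).shift ν) →
      ‖((plaq U p : (Matrix n n ℂ)ˣ) : Matrix n n ℂ) - 1‖ ≤ α)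
    (hA : ∀ b : PBond P j, (blockOf b.src = y ∨ blockOf b.src = y.shift μ ∨ blockOf b.src = y.shift ν ∨ blockOf b.src = (y.shift μ).shift ν) →
      (blockOf b.tgt = y ∨ blockOf b.tgt = y.shift μ ∨ blockOf b.tgt = y.shift ν ∨ blockOf b.tgt = (y.shift μ).shift ν) → ‖A b‖ ≤ a)
    (hRt : ((((P.d + 4) * P.L : ℕ) : ℝ) / 2) * α ≤ t) :
    ‖(((axialT U (emb y) (emb (y.shift ν))) : (Matrix n n ℂ)ˣ) : Matrix n n ℂ) * linAvg (adJ (axialT U (emb (y.shift ν))) A) ⟨y.shift ν, μ⟩ *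
          (((axialT U (emb y) (emb (y.shift ν)))⁻¹ : (Matrix n n ℂ)ˣ) : Matrix n n ℂ) - linAvg (adJ (axialT U (emb y)) A) ⟨y.shift ν, μ⟩‖ ≤
      3 * (((P.d + 2) * P.L : ℕ) : ℝ) * ((((P.d + 2) * P.L : ℕ) : ℝ) * t * a) := by
  classical
  have ht0 : 0 ≤ t := le_trans (by positivity) hRt
  -- the pair-box cut-off, its axial gauge (= `axialT U (emb y)` on the pair blocks), `U^v` within `t` there ((4b)/(4d) verbatim)
  let χ : PBond P j → Prop := fun b =>
    (blockOf b.src = y ∨ blockOf b.src = y.shift μ ∨ blockOf b.src = y.shift ν ∨ blockOf b.src = (y.shift μ).shift ν) ∧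
    (blockOf b.tgt = y ∨ blockOf b.tgt = y.shift μ ∨ blockOf b.tgt = y.shift ν ∨ blockOf b.tgt = (y.shift μ).shift ν)
  let U' : GaugeField P j (Matrix n n ℂ)ˣ := fun b => if χ b then U b else 1
  have hU'U : ∀ b : PBond P j, (blockOf b.src = y ∨ blockOf b.src = y.shift μ ∨ blockOf b.src = y.shift ν ∨ blockOf b.src = (y.shift μ).shift ν) →
      (blockOf b.tgt = y ∨ blockOf b.tgt = y.shift μ ∨ blockOf b.tgt = y.shift ν ∨ blockOf b.tgt = (y.shift μ).shift ν) → U' b = U b :=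
    fun b h1 h2 => by simp only [U', χ, if_pos (And.intro h1 h2)]
  have hU'1 : ∀ b, U' b ∈ U1 (Matrix n n ℂ) := fun b => by
    by_cases hb : χ b
    · simp only [U', if_pos hb]; exact hU1 b hb.1 hb.2
    · simp only [U', if_neg hb]; exact (U1 _).one_mem
  have hplaq' : ∀ p : Plaq P j, (blockOf p.src = y ∨ blockOf p.src = y.shift μ ∨ blockOf p.src = y.shift ν ∨ blockOf p.src = (y.shift μ).shift ν) →
      (blockOf (p.src.shift p.μ) = y ∨ blockOf (p.src.shift p.μ) = y.shift μ ∨ blockOf (p.src.shift p.μ) = y.shift ν ∨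
        blockOf (p.src.shift p.μ) = (y.shift μ).shift ν) →
      (blockOf (p.src.shift p.ν) = y ∨ blockOf (p.src.shift p.ν) = y.shift μ ∨ blockOf (p.src.shift p.ν) = y.shift ν ∨
        blockOf (p.src.shift p.ν) = (y.shift μ).shift ν) →
      (blockOf ((p.src.shift p.μ).shift p.ν) = y ∨ blockOf ((p.src.shift p.μ).shift p.ν) = y.shift μ ∨
        blockOf ((p.src.shift p.μ).shift p.ν) = y.shift ν ∨ blockOf ((p.src.shift p.μ).shift p.ν) = (y.shift μ).shift ν) →
      ‖((plaq U' p : (Matrix n n ℂ)ˣ) : Matrix n n ℂ) - 1‖ ≤ α := fun p c1 c2 c3 c4 => by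
    have hpe : plaq U' p = plaq U p := by
      rw [plaq_eq, plaq_eq, hU'U ⟨p.src, p.μ⟩ c1 c2, hU'U ⟨p.src.shift p.μ, p.ν⟩ c2 c4, hU'U ⟨p.src, p.ν⟩ c1 c3,
        hU'U ⟨p.src.shift p.ν, p.μ⟩ c3 (by rw [PBond.tgt, Site.shift_comm]; exact c4)]
    rw [hpe]; exact hplaq p c1 c2 c3 c4
  have hvv' : ∀ x : Site P j, (blockOf x = y ∨ blockOf x = y.shift μ ∨ blockOf x = y.shift ν ∨ blockOf x = (y.shift μ).shift ν) →
      axialT U (emb y) x = axialT U' (emb y) x := fun x hx => (axialT_congr_of_pairBlocks hj hj2 y μ ν hU'U hx).symm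
  have hvx1 : ∀ x : Site P j, (blockOf x = y ∨ blockOf x = y.shift μ ∨ blockOf x = y.shift ν ∨ blockOf x = (y.shift μ).shift ν) →
      axialT U (emb y) x ∈ U1 (Matrix n n ℂ) := fun x hx => by rw [hvv' x hx]; exact axialT_mem_U1 hU'1 _ x
  have hV₀ : ∀ b : PBond P j, (blockOf b.src = y ∨ blockOf b.src = y.shift μ ∨ blockOf b.src = y.shift ν ∨ blockOf b.src = (y.shift μ).shift ν) →
      (blockOf b.tgt = y ∨ blockOf b.tgt = y.shift μ ∨ blockOf b.tgt = y.shift ν ∨ blockOf b.tgt = (y.shift μ).shift ν) →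
      gaugeU (axialT U (emb y)) U b ∈ U1 (Matrix n n ℂ) ∧ ‖((gaugeU (axialT U (emb y)) U b : (Matrix n n ℂ)ˣ) : Matrix n n ℂ) - 1‖ ≤ t := fun b h1 h2 => by
    have heq : gaugeU (axialT U (emb y)) U b = gaugeU (axialT U' (emb y)) U' b := by
      simp only [gaugeU, hvv' b.src h1, hvv' b.tgt h2, hU'U b h1 h2]
    rw [heq]
    refine ⟨(U1 _).mul_mem ((U1 _).mul_mem (axialT_mem_U1 hU'1 _ _) (hU'1 b)) ((U1 _).inv_mem (axialT_mem_U1 hU'1 _ _)), ?_⟩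
    exact (norm_gaugeU_axialT_sub_one_le_of_pairBlocks hj hj2 hU'1 y μ ν hα hplaq' b h1 h2).trans hRt
  set ℓ : ℝ := (((P.d + 2) * P.L : ℕ) : ℝ) with hℓdef
  have hνμ : (y.shift ν).shift μ = (y.shift μ).shift ν := Site.shift_comm _ _ _
  have incC' : ∀ x : Site P j, (blockOf x = (y.shift ν) ∨ blockOf x = ((y.shift ν).shift μ)) →
      (blockOf x = y ∨ blockOf x = y.shift μ ∨ blockOf x = y.shift ν ∨ blockOf x = (y.shift μ).shift ν) := fun x h => by
    rcases h with h | h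
    · exact Or.inr (Or.inr (Or.inl h))
    · refine Or.inr (Or.inr (Or.inr ?_)); rw [← hνμ]; exact h
  have hctr' : blockOf (emb (y.shift ν)) = y.shift ν := Site.blockOf_emb hj _
  let W₀ : GaugeField P j (Matrix n n ℂ)ˣ := fun b => if χ b then gaugeU (axialT U (emb y)) U b else 1
  have hW₀1 : ∀ b, W₀ b ∈ U1 (Matrix n n ℂ) := fun b => by
    by_cases hb : χ b
    · simp only [W₀, if_pos hb]; exact (hV₀ b hb.1 hb.2).1
    · simp only [W₀, if_neg hb]; exact (U1 _).one_mem
  have hW₀t : ∀ b, ‖((W₀ b : (Matrix n n ℂ)ˣ) : Matrix n n ℂ) - 1‖ ≤ t := fun b => by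
    by_cases hb : χ b
    · simp only [W₀, if_pos hb]; exact (hV₀ b hb.1 hb.2).2
    · simp only [W₀, if_neg hb, Units.val_one, sub_self, norm_zero]; exact ht0
  have hu'1 : ∀ x : Site P j, (blockOf x = (y.shift ν) ∨ blockOf x = ((y.shift ν).shift μ)) → (axialT U (emb (y.shift ν))) x ∈ U1 (Matrix n n ℂ) := fun x hx => by
    rw [axialT_congr_of_twoBlock hj hj2 (⟨y.shift ν, μ⟩ : PBond P (j + 1)) (V' := U') (fun b h1 h2 => (hU'U b (incC' _ h1) (incC' _ h2)).symm) hx]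
    exact axialT_mem_U1 hU'1 _ _
  have hH : ∀ x : Site P j, (blockOf x = (y.shift ν) ∨ blockOf x = ((y.shift ν).shift μ)) →
      (axialT U (emb y) (emb (y.shift ν))) * (axialT U (emb (y.shift ν))) x * ((axialT U (emb y)) x)⁻¹ ∈ U1 (Matrix n n ℂ) ∧
      ‖(((axialT U (emb y) (emb (y.shift ν))) * (axialT U (emb (y.shift ν))) x * ((axialT U (emb y)) x)⁻¹ : (Matrix n n ℂ)ˣ) : Matrix n n ℂ) - 1‖ ≤ ℓ / 2 * t :=
    fun x hx => by
    refine ⟨(U1 _).mul_mem ((U1 _).mul_mem (hvx1 _ (Or.inr (Or.inr (Or.inl hctr')))) (hu'1 x hx)) ((U1 _).inv_mem (hvx1 x (incC' _ hx))), ?_⟩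
    have hHeq : holT W₀ (emb (y.shift ν)) (treeWord (rel (emb (y.shift ν)) x)) = (axialT U (emb y) (emb (y.shift ν))) * (axialT U (emb (y.shift ν))) x * ((axialT U (emb y)) x)⁻¹ := by
      have hloc : holT W₀ (emb (y.shift ν)) (treeWord (rel (emb (y.shift ν)) x)) =
          holT (gaugeU (axialT U (emb y)) U) (emb (y.shift ν)) (treeWord (rel (emb (y.shift ν)) x)) := by
        have := axialT_congr_of_twoBlock hj hj2 (⟨y.shift ν, μ⟩ : PBond P (j + 1)) (V := W₀) (V' := gaugeU (axialT U (emb y)) U) (fun b h1 h2 => ?_) hx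
        · simpa only [axialT] using this
        have hb : χ b := ⟨incC' _ h1, incC' _ h2⟩
        simp only [W₀, if_pos hb]
      rw [hloc, holT_gaugeU_treeWord_eq]
    rw [← hHeq]
    refine (norm_holT_sub_one_le_length_mul hW₀1 ht0 hW₀t _ _).trans ?_
    rw [B7Prop1Explicit.length_treeWord]
    have hin := inBox_rel_of_twoBlock hj hj2 (⟨y.shift ν, μ⟩ : PBond P (j + 1)) hx
    have h2l : (2 : ℝ) * ((l1 (rel (emb (y.shift ν)) x) : ℕ) : ℝ) ≤ ℓ := by
      rw [hℓdef]; exact_mod_cast two_mul_l1_le_of_inBox (⟨y.shift ν, μ⟩ : PBond P (j + 1)) (fun κ => hin κ)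
    nlinarith only [h2l, ht0]
  let D : PBond P j → Matrix n n ℂ := fun b => if (blockOf b.src = (y.shift ν) ∨ blockOf b.src = ((y.shift ν).shift μ)) ∧ (blockOf b.tgt = (y.shift ν) ∨ blockOf b.tgt = ((y.shift ν).shift μ))
    then (((axialT U (emb y) (emb (y.shift ν))) : (Matrix n n ℂ)ˣ) : Matrix n n ℂ) * adJ (axialT U (emb (y.shift ν))) A b * (((axialT U (emb y) (emb (y.shift ν)))⁻¹ : (Matrix n n ℂ)ˣ) : Matrix n n ℂ) - adJ (axialT U (emb y)) A b else 0
  have hD : ∀ b, ‖D b‖ ≤ ℓ * t * a := fun b => by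
    by_cases hb : (blockOf b.src = (y.shift ν) ∨ blockOf b.src = ((y.shift ν).shift μ)) ∧ (blockOf b.tgt = (y.shift ν) ∨ blockOf b.tgt = ((y.shift ν).shift μ))
    · simp only [D, if_pos hb]
      set Hx : (Matrix n n ℂ)ˣ := (axialT U (emb y) (emb (y.shift ν))) * (axialT U (emb (y.shift ν))) b.src * ((axialT U (emb y)) b.src)⁻¹ with hHx
      have hgv : (axialT U (emb y) (emb (y.shift ν))) * (axialT U (emb (y.shift ν))) b.src = Hx * (axialT U (emb y)) b.src := by rw [hHx]; group
      have hid0 : (((axialT U (emb y) (emb (y.shift ν))) : (Matrix n n ℂ)ˣ) : Matrix n n ℂ) * adJ (axialT U (emb (y.shift ν))) A b * (((axialT U (emb y) (emb (y.shift ν)))⁻¹ : (Matrix n n ℂ)ˣ) : Matrix n n ℂ) =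
          (Hx : Matrix n n ℂ) * adJ (axialT U (emb y)) A b * ((Hx⁻¹ : (Matrix n n ℂ)ˣ) : Matrix n n ℂ) := by
        have e1 : (((axialT U (emb y) (emb (y.shift ν))) : (Matrix n n ℂ)ˣ) : Matrix n n ℂ) * adJ (axialT U (emb (y.shift ν))) A b * (((axialT U (emb y) (emb (y.shift ν)))⁻¹ : (Matrix n n ℂ)ˣ) : Matrix n n ℂ) =
            ((((axialT U (emb y) (emb (y.shift ν))) * (axialT U (emb (y.shift ν))) b.src : (Matrix n n ℂ)ˣ)) : Matrix n n ℂ) * A b * (((((axialT U (emb y) (emb (y.shift ν))) * (axialT U (emb (y.shift ν))) b.src)⁻¹ : (Matrix n n ℂ)ˣ)) : Matrix n n ℂ) := by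
          simp only [adJ, mul_inv_rev, Units.val_mul]; noncomm_ring
        have e2 : (Hx : Matrix n n ℂ) * adJ (axialT U (emb y)) A b * ((Hx⁻¹ : (Matrix n n ℂ)ˣ) : Matrix n n ℂ) =
            (((Hx * (axialT U (emb y)) b.src : (Matrix n n ℂ)ˣ)) : Matrix n n ℂ) * A b * ((((Hx * (axialT U (emb y)) b.src)⁻¹ : (Matrix n n ℂ)ˣ)) : Matrix n n ℂ) := by
          simp only [adJ, mul_inv_rev, Units.val_mul]; noncomm_ring
        rw [e1, e2, hgv]
      rw [hid0]
      obtain ⟨hHU, hHt⟩ := hH b.src hb.1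
      calc ‖(Hx : Matrix n n ℂ) * adJ (axialT U (emb y)) A b * ((Hx⁻¹ : (Matrix n n ℂ)ˣ) : Matrix n n ℂ) - adJ (axialT U (emb y)) A b‖ ≤ 2 * ‖(Hx : Matrix n n ℂ) - 1‖ * ‖adJ (axialT U (emb y)) A b‖ :=
            norm_conj_sub_le_of_U1 hHU _
        _ ≤ 2 * (ℓ / 2 * t) * a := by
            have hZ : ‖adJ (axialT U (emb y)) A b‖ ≤ a := (norm_units_conj_le (hvx1 b.src (incC' _ hb.1)) _).trans (hA b (incC' _ hb.1) (incC' _ hb.2))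
            have : 0 ≤ ‖(Hx : Matrix n n ℂ) - 1‖ := norm_nonneg _
            nlinarith only [hZ, hHt, this, norm_nonneg (adJ (axialT U (emb y)) A b)]
        _ = ℓ * t * a := by ring
    · simp only [D, if_neg hb, norm_zero]; positivity
  have hdiff : (((axialT U (emb y) (emb (y.shift ν))) : (Matrix n n ℂ)ˣ) : Matrix n n ℂ) * linAvg (adJ (axialT U (emb (y.shift ν))) A) ⟨y.shift ν, μ⟩ * (((axialT U (emb y) (emb (y.shift ν)))⁻¹ : (Matrix n n ℂ)ˣ) : Matrix n n ℂ) - linAvg (adJ (axialT U (emb y)) A) ⟨y.shift ν, μ⟩ =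
      linAvg D ⟨y.shift ν, μ⟩ := by
    rw [← linAvg_units_conj, ← linAvg_sub]
    refine linAvg_congr₂ hj (⟨y.shift ν, μ⟩ : PBond P (j + 1)) fun b h1 h2 => ?_
    have hb : (blockOf b.src = (y.shift ν) ∨ blockOf b.src = ((y.shift ν).shift μ)) ∧ (blockOf b.tgt = (y.shift ν) ∨ blockOf b.tgt = ((y.shift ν).shift μ)) := ⟨h1, h2⟩
    simp only [D, if_pos hb]
  rw [hdiff]
  exact norm_linAvg_le D (by positivity) hD ⟨y.shift ν, μ⟩

end YMDAG.N18.TransportOfRecord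

end
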